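import Mathlib
import Summits.NavierStokesRegularity.NavierStokesRegularity.Theorems.FilamentSkeletonRssStadiumFootTangential
import Summits.NavierStokesRegularity.NavierStokesRegularity.Theorems.FilamentSkeletonRssStadiumLegProfiles
import Summits.NavierStokesRegularity.NavierStokesRegularity.Theorems.FilamentSkeletonRssStadiumPartnerPiece

/-!
# Route `FilamentSkeletonRss` · child crux `TangentSkeletonNearStraightL` (stmt-NavierStokesRegularity-23320) · registered line
# `child_tangent_analytic_strip_L` (b0b56c52900dd90a), stub `stub_stripPropagation` — assembly piece: THE FOOT ESTIMATE IN THE STUB'S TERMS, CLOSED FORM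

Third assembly piece of the quarter-width blueprint (evidence `CORNER-QUARTER-BLUEPRINT-leafhand-15-g0.md` on 23320).  The abstract foot
estimate `Theorems.StadiumFootTangential.re_chord_sq_ge_of_feet` takes continuous deviation profiles along the two vertical legs and four
integrals `J₁, J₂, I₁, I₂` of them.  Here the profiles are the stadium's own (`Theorems.StadiumLegProfiles.leg_profiles`: disc radii `R₁`, `R₂`
at the two feet, `‖F′‖ ≤ M`, clamped — hence continuous — majorants), and the four integrals are put in CLOSED FORM
(`Theorems.StadiumLegProfiles.integral_legE_eq / integral_legQE_eq` and `integral_legQ_eq` below), so that the positivity test for a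
(target, source) pair of the descent becomes an inequality between explicit elementary expressions in `(|x₂−x₁|, Y, η, R₁, R₂, M, Rb)`:
  `(c₀ − J₁ − J₂)² − (√((Y−η)² + YηRb²) + I₁ + I₂)² ≤ Re Σᵢ (Fᵢ(x₁+iY) − Fᵢ(x₂+iη))²`   (`foot_re_ge_closed_form`),
  `I(R,t) = √3·2M(t − (R−t)ℓ − t²/(2R))`, `J₁ = 6M²·K(R₁,Y)`, `J₂ = 6M²·K(R₂,η) + Rb·√3M(η − (R₂−η)ℓ₂)`,
  `K(R,t) = 2t − (R−t)ℓ² − 2(R−t)ℓ + (R²−t²)ℓ/(2R) − t/2 − t²/(4R)`, `ℓ = log(R/(R−t))`,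
with `c₀` any lower bound of the chord projection `Σ (X(x₂)−X(x₁))ᵢ X′(x₁)ᵢ` (near-straightness gives `(1 − Rb²/2)|x₂ − x₁|`).
At the registered corner (`M = 2`, `Rb = 1/2`, `R₁ = 3hs/4`, `Y = hs/4`): `I₁ = 0.039hs`, `J₁ = 0.040hs` (hand's census).
HONEST FRAMING: bookkeeping for a HYPOTHETICAL filament skeleton on the NEGATIVE side of a MODEL route; the stub `stub_stripPropagation` is NOT
closed by this file; nothing here bears on Navier–Stokes regularity or blow-up.  `--supports stmt-NavierStokesRegularity-23320`.
-/

set_option linter.dupNamespace false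

noncomputable section

namespace Summit.NavierStokesRegularity.NavierStokesRegularity.Theorems.StadiumFootClosedForm

open Set MeasureTheory
open scoped InnerProductSpace BigOperators
open Summit.NavierStokesRegularity.NavierStokesRegularity.Theorems.StadiumFootTangential
open Summit.NavierStokesRegularity.NavierStokesRegularity.Theorems.StadiumLegProfiles
open Summit.NavierStokesRegularity.NavierStokesRegularity.Theorems.StadiumDeviationPackage
open Summit.NavierStokesRegularity.NavierStokesRegularity.Theorems.StadiumPartnerPiece

/-- **Closed form of the `Q`-integral**: `∫₀ᵗ log(R/(R−u)) du = t − (R−t)·log(R/(R−t))` for `0 ≤ t < R`. [folklore] -/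
theorem integral_log_ratio_eq {R t : ℝ} (ht : 0 ≤ t) (htR : t < R) :
    ∫ u in (0:ℝ)..t, Real.log (R / (R - u)) = t - (R - t) * Real.log (R / (R - t)) := by
  have hIcc : uIcc (0:ℝ) t = Icc 0 t := uIcc_of_le ht
  have hR : 0 < R := lt_of_le_of_lt ht htR
  have hder : ∀ u ∈ uIcc (0:ℝ) t,
      HasDerivAt (fun u : ℝ => u - (R - u) * (Real.log R - Real.log (R - u))) (Real.log (R / (R - u))) u := by
    intro u hu
    rw [hIcc] at hu
    have hpos : 0 < R - u := by linarith [hu.2]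
    have h1 : HasDerivAt (fun u : ℝ => R - u) (-1) u := (hasDerivAt_id u).const_sub R
    have hℓ : HasDerivAt (fun u : ℝ => Real.log R - Real.log (R - u)) (1 / (R - u)) u := by
      have h2 : HasDerivAt (fun u : ℝ => Real.log (R - u)) (-1 / (R - u)) u := by
        have h := h1.log hpos.ne'
        simpa [div_eq_mul_inv, neg_mul, one_mul] using h
      have h3 := (hasDerivAt_const u (Real.log R)).sub h2
      refine h3.congr_deriv ?_
      ring
    have h4 := (hasDerivAt_id u).sub (h1.mul hℓ)
    refine h4.congr_deriv ?_
    rw [Real.log_div hR.ne' hpos.ne']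
    field_simp
    ring
  have hcont : ContinuousOn (fun u : ℝ => Real.log (R / (R - u))) (uIcc (0:ℝ) t) := by
    rw [hIcc]
    refine ContinuousOn.log (continuousOn_const.div (continuousOn_const.sub continuousOn_id) fun u hu => ?_) fun u hu => ?_
    · have : 0 < R - u := by linarith [hu.2]
      exact this.ne'
    · have h1 : 0 < R - u := by linarith [hu.2]
      exact (div_pos hR h1).ne'
  rw [intervalIntegral.integral_eq_sub_of_hasDerivAt hder hcont.intervalIntegrable]
  have hRt : 0 < R - t := by linarith
  simp only [Real.log_div hR.ne' hRt.ne', sub_zero, sub_self, mul_zero]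

/-- **The foot estimate in the stub's terms, closed form.**  Stadium `S = {|Im| < hs, |Re − cc| < L + hs}`; `F` holomorphic on `S` with
`‖F′‖ ≤ M`, `Σ (F′)ᵢ² = 1`, `F = cplx ∘ X` on the real trace, `X` differentiable with unit speed and tangent oscillation `≤ Rb` (`0 ≤ Rb`);
target foot `x₁` with height `0 ≤ Y < R₁`, source foot `x₂` with height `0 ≤ η < R₂`, admissible radii (`Rⱼ < hs`, `|xⱼ − cc| + Rⱼ < L + hs`);
`c₀` a lower bound of the chord projection `Σᵢ (X(x₂) − X(x₁))ᵢ·X′(x₁)ᵢ`.  With `ℓⱼ = log(Rⱼ/(Rⱼ − ·))`,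
`I₁ = √3·2M(Y − (R₁−Y)ℓ₁ − Y²/(2R₁))`, `I₂` likewise, `J₁ = 6M²K(R₁,Y)`, `J₂ = 6M²K(R₂,η) + Rb·√3M(η − (R₂−η)ℓ₂)`:
if `0 ≤ c₀ − J₁ − J₂` then `(c₀ − J₁ − J₂)² − (√((Y−η)²+YηRb²) + I₁ + I₂)² ≤ Re Σᵢ (Fᵢ(x₁+iY) − Fᵢ(x₂+iη))²`. [folklore] -/
theorem foot_re_ge_closed_form {hs L cc M : ℝ} {F : ℂ → (Fin 3 → ℂ)}
    (hF : DifferentiableOn ℂ F {z : ℂ | |z.im| < hs ∧ |z.re - cc| < L + hs})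
    (hM : ∀ z ∈ {z : ℂ | |z.im| < hs ∧ |z.re - cc| < L + hs}, ‖deriv F z‖ ≤ M)
    (hunit : ∀ w ∈ {z : ℂ | |z.im| < hs ∧ |z.re - cc| < L + hs}, ∑ i, (deriv F w i) ^ 2 = 1)
    {X : ℝ → EuclideanSpace ℝ (Fin 3)} (hX : Differentiable ℝ X) (hXu : ∀ τ, ‖deriv X τ‖ = 1)
    {Rb : ℝ} (hosc : ∀ τ σ, ‖deriv X τ - deriv X σ‖ ≤ Rb)
    (hFX : ∀ r : ℝ, (r : ℂ) ∈ {z : ℂ | |z.im| < hs ∧ |z.re - cc| < L + hs} →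
      F r = fun i => ((⟪X r, EuclideanSpace.single i (1:ℝ)⟫_ℝ : ℝ) : ℂ))
    (hhs : 0 < hs) {x₁ x₂ Y η R₁ R₂ : ℝ} (hY : 0 ≤ Y) (hη : 0 ≤ η)
    (hR₁Y : Y < R₁) (hR₁hs : R₁ < hs) (hR₁end : |x₁ - cc| + R₁ < L + hs)
    (hR₂η : η < R₂) (hR₂hs : R₂ < hs) (hR₂end : |x₂ - cc| + R₂ < L + hs)
    {c₀ : ℝ} (hc₀ : c₀ ≤ ∑ i, (⟪X x₂, EuclideanSpace.single i (1:ℝ)⟫_ℝ - ⟪X x₁, EuclideanSpace.single i (1:ℝ)⟫_ℝ) *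
      ⟪deriv X x₁, EuclideanSpace.single i (1:ℝ)⟫_ℝ)
    (ha : 0 ≤ c₀ - 6 * M ^ 2 * (2 * Y - (R₁ - Y) * Real.log (R₁ / (R₁ - Y)) ^ 2 - 2 * (R₁ - Y) * Real.log (R₁ / (R₁ - Y)) +
        (R₁ ^ 2 - Y ^ 2) * Real.log (R₁ / (R₁ - Y)) / (2 * R₁) - Y / 2 - Y ^ 2 / (4 * R₁))
      - (6 * M ^ 2 * (2 * η - (R₂ - η) * Real.log (R₂ / (R₂ - η)) ^ 2 - 2 * (R₂ - η) * Real.log (R₂ / (R₂ - η)) +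
        (R₂ ^ 2 - η ^ 2) * Real.log (R₂ / (R₂ - η)) / (2 * R₂) - η / 2 - η ^ 2 / (4 * R₂))
        + Rb * (√3 * (M * (η - (R₂ - η) * Real.log (R₂ / (R₂ - η))))))) :
    (c₀ - 6 * M ^ 2 * (2 * Y - (R₁ - Y) * Real.log (R₁ / (R₁ - Y)) ^ 2 - 2 * (R₁ - Y) * Real.log (R₁ / (R₁ - Y)) +
        (R₁ ^ 2 - Y ^ 2) * Real.log (R₁ / (R₁ - Y)) / (2 * R₁) - Y / 2 - Y ^ 2 / (4 * R₁))
      - (6 * M ^ 2 * (2 * η - (R₂ - η) * Real.log (R₂ / (R₂ - η)) ^ 2 - 2 * (R₂ - η) * Real.log (R₂ / (R₂ - η)) +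
        (R₂ ^ 2 - η ^ 2) * Real.log (R₂ / (R₂ - η)) / (2 * R₂) - η / 2 - η ^ 2 / (4 * R₂))
        + Rb * (√3 * (M * (η - (R₂ - η) * Real.log (R₂ / (R₂ - η))))))) ^ 2
      - (√((Y - η) ^ 2 + Y * η * Rb ^ 2) + √3 * (2 * M * (Y - (R₁ - Y) * Real.log (R₁ / (R₁ - Y)) - Y ^ 2 / (2 * R₁)))
          + √3 * (2 * M * (η - (R₂ - η) * Real.log (R₂ / (R₂ - η)) - η ^ 2 / (2 * R₂)))) ^ 2 ≤
      (∑ i, (F ((x₁ : ℂ) + (Y : ℂ) * Complex.I) i - F ((x₂ : ℂ) + (η : ℂ) * Complex.I) i) ^ 2).re := by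
  set S : Set ℂ := {z : ℂ | |z.im| < hs ∧ |z.re - cc| < L + hs} with hS
  have hSo : IsOpen S := isOpen_stadium hs (L + hs) cc
  have hx₁ : |x₁ - cc| < L + hs := by linarith
  have hx₂ : |x₂ - cc| < L + hs := by linarith
  -- the legs lie in `S`
  have hleg : ∀ {x R t : ℝ}, |x - cc| + R < L + hs → R < hs → 0 ≤ t → t < R →
      ∀ u ∈ Icc (0:ℝ) t, (x : ℂ) + (u : ℂ) * Complex.I ∈ S := by
    intro x R t hxR hRh ht0 htR u hu
    have hR0 : 0 < R := lt_of_le_of_lt ht0 htR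
    refine ⟨?_, ?_⟩
    · simp only [Complex.add_im, Complex.ofReal_im, Complex.mul_im, Complex.ofReal_re, Complex.I_im, Complex.I_re,
        mul_one, mul_zero, zero_add, add_zero]
      rw [abs_of_nonneg hu.1]; linarith [hu.2]
    · simp only [Complex.add_re, Complex.ofReal_re, Complex.mul_re, Complex.ofReal_im, Complex.I_re, Complex.I_im,
        mul_zero, mul_one, sub_zero, add_zero]
      linarith
  have hmem₁ := hleg hR₁end hR₁hs hY hR₁Y
  have hmem₂ := hleg hR₂end hR₂hs hη hR₂η
  -- feet values and tangents in coordinates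
  set X₁ : Fin 3 → ℝ := fun i => ⟪X x₁, EuclideanSpace.single i (1:ℝ)⟫_ℝ with hX₁
  set X₂ : Fin 3 → ℝ := fun i => ⟪X x₂, EuclideanSpace.single i (1:ℝ)⟫_ℝ with hX₂
  set T₁ : Fin 3 → ℝ := fun i => ⟪deriv X x₁, EuclideanSpace.single i (1:ℝ)⟫_ℝ with hT₁
  set T₂ : Fin 3 → ℝ := fun i => ⟪deriv X x₂, EuclideanSpace.single i (1:ℝ)⟫_ℝ with hT₂
  have hFx₁ : ∀ i, F (x₁ : ℂ) i = (X₁ i : ℂ) := fun i => by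
    rw [hFX x₁ ⟨by simpa using hhs, by simpa using hx₁⟩]
  have hFx₂ : ∀ i, F (x₂ : ℂ) i = (X₂ i : ℂ) := fun i => by
    rw [hFX x₂ ⟨by simpa using hhs, by simpa using hx₂⟩]
  have hT₁u : ∑ i, T₁ i ^ 2 = 1 := (unit_tangent_coords hXu hosc x₁ x₂).1
  have hT₂u : ∑ i, T₂ i ^ 2 = 1 := (unit_tangent_coords hXu hosc x₂ x₁).1
  have hρ : √(∑ i, (T₁ i - T₂ i) ^ 2) ≤ Rb := (unit_tangent_coords hXu hosc x₁ x₂).2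
  -- the clamped continuous leg profiles
  have hR₁ : 0 < R₁ := lt_of_le_of_lt hY hR₁Y
  have hR₂ : 0 < R₂ := lt_of_le_of_lt hη hR₂η
  obtain ⟨hq₁, he₁⟩ := leg_profiles hF hM hX hFX hhs hR₁ hR₁hs hR₁end hR₁Y
  obtain ⟨hq₂, he₂⟩ := leg_profiles hF hM hX hFX hhs hR₂ hR₂hs hR₂end hR₂η
  have hq₁c := continuous_legQ M hY hR₁Y
  have he₁c := continuous_legE M hY hR₁Y
  have hq₂c := continuous_legQ M hη hR₂η
  have he₂c := continuous_legE M hη hR₂η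
  -- closed forms of the four integrals (clamp = identity on the leg)
  have hI₁ : ∫ u in (0:ℝ)..Y, √3 * (2 * M * (Real.log (R₁ / (R₁ - max 0 (min u Y))) - max 0 (min u Y) / R₁)) =
      √3 * (2 * M * (Y - (R₁ - Y) * Real.log (R₁ / (R₁ - Y)) - Y ^ 2 / (2 * R₁))) := integral_legE_clamp_eq M hY hR₁Y
  have hI₂ : ∫ u in (0:ℝ)..η, √3 * (2 * M * (Real.log (R₂ / (R₂ - max 0 (min u η))) - max 0 (min u η) / R₂)) =
      √3 * (2 * M * (η - (R₂ - η) * Real.log (R₂ / (R₂ - η)) - η ^ 2 / (2 * R₂))) := integral_legE_clamp_eq M hη hR₂η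
  have hJ₁ : ∫ u in (0:ℝ)..Y, √3 * (M * Real.log (R₁ / (R₁ - max 0 (min u Y)))) *
      (√3 * (2 * M * (Real.log (R₁ / (R₁ - max 0 (min u Y))) - max 0 (min u Y) / R₁)) + 0) =
      6 * M ^ 2 * (2 * Y - (R₁ - Y) * Real.log (R₁ / (R₁ - Y)) ^ 2 - 2 * (R₁ - Y) * Real.log (R₁ / (R₁ - Y)) +
        (R₁ ^ 2 - Y ^ 2) * Real.log (R₁ / (R₁ - Y)) / (2 * R₁) - Y / 2 - Y ^ 2 / (4 * R₁)) := by
    rw [← integral_legQE_eq M hY hR₁Y]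
    refine intervalIntegral.integral_congr fun u hu => ?_
    rw [uIcc_of_le hY] at hu
    simp only [clamp_eq hu, add_zero]
  have hJ₂ : ∫ u in (0:ℝ)..η, √3 * (M * Real.log (R₂ / (R₂ - max 0 (min u η)))) *
      (√3 * (2 * M * (Real.log (R₂ / (R₂ - max 0 (min u η))) - max 0 (min u η) / R₂)) + Rb) =
      6 * M ^ 2 * (2 * η - (R₂ - η) * Real.log (R₂ / (R₂ - η)) ^ 2 - 2 * (R₂ - η) * Real.log (R₂ / (R₂ - η)) +
        (R₂ ^ 2 - η ^ 2) * Real.log (R₂ / (R₂ - η)) / (2 * R₂) - η / 2 - η ^ 2 / (4 * R₂))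
        + Rb * (√3 * (M * (η - (R₂ - η) * Real.log (R₂ / (R₂ - η))))) := by
    have hsplit : (fun u : ℝ => √3 * (M * Real.log (R₂ / (R₂ - max 0 (min u η)))) *
        (√3 * (2 * M * (Real.log (R₂ / (R₂ - max 0 (min u η))) - max 0 (min u η) / R₂)) + Rb)) =
        fun u => (√3 * (M * Real.log (R₂ / (R₂ - max 0 (min u η))))) *
          (√3 * (2 * M * (Real.log (R₂ / (R₂ - max 0 (min u η))) - max 0 (min u η) / R₂)))
          + Rb * (√3 * (M * Real.log (R₂ / (R₂ - max 0 (min u η))))) := by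
      funext u; ring
    have hc1 : Continuous fun u : ℝ => (√3 * (M * Real.log (R₂ / (R₂ - max 0 (min u η))))) *
        (√3 * (2 * M * (Real.log (R₂ / (R₂ - max 0 (min u η))) - max 0 (min u η) / R₂))) := hq₂c.mul he₂c
    have hc2 : Continuous fun u : ℝ => Rb * (√3 * (M * Real.log (R₂ / (R₂ - max 0 (min u η))))) :=
      continuous_const.mul hq₂c
    rw [hsplit, intervalIntegral.integral_add (hc1.intervalIntegrable _ _) (hc2.intervalIntegrable _ _),
      intervalIntegral.integral_const_mul]
    have e1 : ∫ u in (0:ℝ)..η, (√3 * (M * Real.log (R₂ / (R₂ - max 0 (min u η))))) *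
        (√3 * (2 * M * (Real.log (R₂ / (R₂ - max 0 (min u η))) - max 0 (min u η) / R₂))) =
        6 * M ^ 2 * (2 * η - (R₂ - η) * Real.log (R₂ / (R₂ - η)) ^ 2 - 2 * (R₂ - η) * Real.log (R₂ / (R₂ - η)) +
          (R₂ ^ 2 - η ^ 2) * Real.log (R₂ / (R₂ - η)) / (2 * R₂) - η / 2 - η ^ 2 / (4 * R₂)) := by
      rw [← integral_legQE_eq M hη hR₂η]
      refine intervalIntegral.integral_congr fun u hu => ?_
      rw [uIcc_of_le hη] at hu
      simp only [clamp_eq hu]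
    have e2 : ∫ u in (0:ℝ)..η, √3 * (M * Real.log (R₂ / (R₂ - max 0 (min u η)))) =
        √3 * (M * (η - (R₂ - η) * Real.log (R₂ / (R₂ - η)))) := by
      have e3 : ∫ u in (0:ℝ)..η, √3 * (M * Real.log (R₂ / (R₂ - max 0 (min u η)))) =
          ∫ u in (0:ℝ)..η, (√3 * M) * Real.log (R₂ / (R₂ - u)) := by
        refine intervalIntegral.integral_congr fun u hu => ?_
        rw [uIcc_of_le hη] at hu
        simp only [clamp_eq hu]; ring
      rw [e3, intervalIntegral.integral_const_mul, integral_log_ratio_eq hη hR₂η]; ring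
    rw [e1, e2]
  -- apply the abstract foot estimate
  have h := re_chord_sq_ge_of_feet hSo hF hunit hY hη hmem₁ hmem₂ X₁ X₂ hFx₁ hFx₂ T₁ T₂ hT₁u hT₂u hρ hc₀
    hq₁c he₁c hq₂c he₂c hq₁ he₁ hq₂ he₂ (by rw [hJ₁, hJ₂]; exact ha)
  rw [hJ₁, hJ₂, hI₁, hI₂] at h
  exact h

end Summit.NavierStokesRegularity.NavierStokesRegularity.Theorems.StadiumFootClosedForm

end
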